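import Summits.Schanuel.Schanuel.Theorems.ZilberEacFibreCurveDegenerate
import Summits.Schanuel.Schanuel.Theorems.ZilberEacGraphSurfaceComplete
import HarnessLib

/-!
# Logarithmic strips, VIII: surfaces over a graph base of degree `≥ 2` whose fibre polynomial has a
# unique monomial of maximal `x`-degree; the residual class, typed; examples

HONEST FRAMING.  Cell `pub-schanuel` (Zilber's Exponential-Algebraic Closedness, case ladder;
host summit Schanuel), seat 2, gen 18 (HANDOFF O65).  (A) Assembly of gen 17's dichotomy
(`exists_support_y1_eq_zero`) with the tilted-edge theorem
`unprojectedDense_fibreCurveSurface_of_uniqueTop`: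
**`unprojectedDensityQuestion_graphSurface_of_uniqueTop`** — `deg p ≥ 2` (NO condition on the
leading term), `P ∈ ℂ[x, y₀, y₁]` irreducible with torus fibres over infinitely many base points
and a UNIQUE monomial of maximal `x₀`-degree ⟹ `{x₁ = p(x₀), P(x₀; y₀, y₁) = 0}` is in
Mantova–Masser's case AND has Zariski-dense exponential points.  (B) **The residual class, typed**
(`fibreCurveSurface_residual_of_not_unprojectedDense`): if a fibre curve `{x₁ = p(x₀), P(x₀, y₀) = 0}`
(`deg p ≥ 2`, `P` irreducible with two `y₀`-degrees) does NOT have Zariski-dense exponential points,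
then `Re(lc(p)·i^{deg p}) = 0`, the row of maximal `x₀`-degree of `supp P` reaches both extreme
`y₀`-degrees, and every nonzero root `θ` of the top-row polynomial satisfies `dτ log|θ| + σ = 0`
— this is EXACTLY what stays open over graph bases of degree `≥ 2` (e.g.
`{x₁ = -ix₀²/(2π), x₀(y₀ - 1) = 1}`; a Schanuel/Shapiro-type question).  (C) Examples not covered by
gen 17 (`Re(lc(p)·i^{deg p}) = 0`): `{x₁ = x₀³, y₀² = x₀}` and `{x₁ = ix₀², y₀² = x₀}` — case ∧ dense.  (D) The index swap `x₀ = p(x₁)` (`unprojectedDense_fibreCurveSurface_swap_iff`).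
NOT Schanuel's conjecture (neither used nor implied; EAC ⇏ SC); `EC(3,2)` stays OPEN; classes of
instances of an OPEN question (PLMS 2024, §1 p. 5).
-/

noncomputable section

open Filter Topology Set Complex MvPolynomial
open Literature.NumberTheory.Transcendental Literature.ModelTheory.Zilber
open Literature.ModelTheory.ExponentialFields

set_option linter.dupNamespace false

namespace Summit.Schanuel.Schanuel.Theorems

/-! ## Part A. Unique top monomial, fibre polynomial in `ℂ[x, y₀, y₁]` -/

section UniqueTop

variable (p : Polynomial ℂ) {P : MvPolynomial (Fin 3) ℂ}

/-- **Every surface of the case over `x₁ = p(x₀)`, `deg p ≥ 2`, whose fibre polynomial has a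
unique monomial of maximal `x₀`-degree**: case ∧ Zariski-dense exponential points (no condition on
the leading term of `p`).
[cite: MantovaMasser2023, §1 Further remarks, p. 5 (the question, open in general)] (new) -/
theorem unprojectedDensityQuestion_graphSurface_of_uniqueTop (hd : 2 ≤ p.natDegree)
    (hirr : Irreducible P)
    (hfib : Set.Infinite {t : ℂ | ∃ c : Fin 2 → ℂ, c 0 ≠ 0 ∧ c 1 ≠ 0 ∧
      MvPolynomial.eval ![t, c 0, c 1] P = 0})
    {m₀ : Fin 3 →₀ ℕ} (hm₀ : m₀ ∈ P.support) (huniq : ∀ m ∈ P.support, m ≠ m₀ → m 0 < m₀ 0) :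
    MMCaseDimPiOneFree {w : Fin 2 ⊕ Fin 2 → ℂ | w (Sum.inl 1) = p.eval (w (Sum.inl 0)) ∧
        MvPolynomial.eval ![w (Sum.inl 0), w (Sum.inr 0), w (Sum.inr 1)] P = 0} ∧
      UnprojectedDense {w : Fin 2 ⊕ Fin 2 → ℂ | w (Sum.inl 1) = p.eval (w (Sum.inl 0)) ∧
        MvPolynomial.eval ![w (Sum.inl 0), w (Sum.inr 0), w (Sum.inr 1)] P = 0} := by
  classical
  by_cases h2 : ∃ m ∈ P.support, m 2 ≠ 0
  · exact unprojectedDensityQuestion_graphSurface_of_y1 p hd hirr h2 hfib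
  refine ⟨mmCase_graphSurface p P hd hirr hfib, ?_⟩
  push Not at h2
  obtain ⟨P₂, hP₂⟩ := exists_rename_castSucc_eq h2
  subst hP₂
  have hirr₂ : Irreducible P₂ := irreducible_of_rename_castSucc hirr
  have h1' : ∃ v ∈ P₂.support, ∃ v' ∈ P₂.support, v 1 ≠ v' 1 := by
    by_contra hall
    push Not at hall
    obtain ⟨v₀, hv₀⟩ := MvPolynomial.ne_zero_iff.1 hirr₂.ne_zero
    have hv₀s : v₀ ∈ P₂.support := MvPolynomial.mem_support_iff.2 hv₀
    have hfin := finite_fibres_of_sameDegree hirr₂.ne_zero (fun v hv => hall v hv v₀ hv₀s)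
    refine hfib (hfin.subset ?_)
    rintro t ⟨c, h0, -, hc⟩
    exact ⟨c 0, h0, by rwa [eval_vec3_rename_castSucc] at hc⟩
  -- transfer the unique top monomial to `P₂`
  have hsupp : (rename (Fin.castSucc : Fin 2 → Fin 3) P₂).support =
      Finset.image (Finsupp.mapDomain Fin.castSucc) P₂.support :=
    support_rename_of_injective (Fin.castSucc_injective 2)
  have hinj : Function.Injective (Finsupp.mapDomain (Fin.castSucc : Fin 2 → Fin 3) :
      (Fin 2 →₀ ℕ) → (Fin 3 →₀ ℕ)) := Finsupp.mapDomain_injective (Fin.castSucc_injective 2)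
  have h0 : ∀ v : Fin 2 →₀ ℕ, (Finsupp.mapDomain (Fin.castSucc : Fin 2 → Fin 3) v) 0 = v 0 := by
    intro v
    have := Finsupp.mapDomain_apply (Fin.castSucc_injective 2) v (0 : Fin 2)
    rwa [Fin.castSucc_zero] at this
  rw [hsupp] at hm₀ huniq
  obtain ⟨v₀, hv₀, rfl⟩ := Finset.mem_image.1 hm₀
  have huniq' : ∀ v ∈ P₂.support, v ≠ v₀ → v 0 < v₀ 0 := by
    intro v hv hne
    have h := huniq (Finsupp.mapDomain Fin.castSucc v) (Finset.mem_image_of_mem _ hv)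
      (fun h => hne (hinj h))
    rwa [h0, h0] at h
  rw [← fibreCurveSurface_eq]
  exact unprojectedDense_fibreCurveSurface_of_uniqueTop p hd hirr₂ h1' hv₀ huniq'

end UniqueTop

/-! ## Part B. The residual class, typed -/

section Residual

variable (p : Polynomial ℂ) {P : MvPolynomial (Fin 2) ℂ}

/-- **What stays open over graph bases of degree `≥ 2`, exactly.**  If `{x₁ = p(x₀), P(x₀, y₀) = 0}`
(`deg p = d ≥ 2`, `P` irreducible with two monomials of different `y₀`-degree) does NOT have
Zariski-dense exponential points, then: `Re(lc(p)·i^d) = 0`; the row of maximal `x₀`-degree of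
`supp P` contains a monomial of maximal AND one of minimal `y₀`-degree (over the whole support); and
every nonzero root `θ` of the top-row polynomial has `dτ log|θ| + σ = 0` (`τ = Re(lc(p)·i^{d-1})`,
`σ = Re(p_{d-1}·i^{d-1})`).  (Contrapositive assembly of gen 17 and of
`unprojectedDense_fibreCurveSurface_of_topRight/_of_topLeft/_of_topRow`.) (new) -/
theorem fibreCurveSurface_residual_of_not_unprojectedDense (hd : 2 ≤ p.natDegree)
    (hirr : Irreducible P) (h1 : ∃ v ∈ P.support, ∃ v' ∈ P.support, v 1 ≠ v' 1)
    (hnot : ¬ UnprojectedDense {w : Fin 2 ⊕ Fin 2 → ℂ | w (Sum.inl 1) = p.eval (w (Sum.inl 0)) ∧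
      MvPolynomial.eval ![w (Sum.inl 0), w (Sum.inr 0)] P = 0}) :
    (p.leadingCoeff * I ^ p.natDegree).re = 0 ∧
    (∀ v₀ ∈ P.support, (∀ v ∈ P.support, v 0 ≤ v₀ 0) →
      (∃ vR ∈ P.support, vR 0 = v₀ 0 ∧ ∀ u ∈ P.support, u 1 ≤ vR 1) ∧
      (∃ vL ∈ P.support, vL 0 = v₀ 0 ∧ ∀ u ∈ P.support, vL 1 ≤ u 1)) ∧
    (∀ N₀ : ℕ, (∀ v ∈ P.support, v 0 ≤ N₀) → ∀ va ∈ P.support, ∀ vc ∈ P.support,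
      va 0 = N₀ → vc 0 = N₀ → va 1 ≠ vc 1 → ∀ θ : ℂ, θ ≠ 0 →
      (∑ v ∈ P.support.filter (fun v : Fin 2 →₀ ℕ => v 0 = N₀),
        Polynomial.C (P.coeff v) * Polynomial.X ^ (v 1)).eval θ = 0 →
      (p.natDegree : ℝ) * (p.leadingCoeff * I ^ (p.natDegree - 1)).re * Real.log ‖θ‖ +
        (p.coeff (p.natDegree - 1) * I ^ (p.natDegree - 1)).re = 0) := by
  classical
  refine ⟨?_, fun v₀ hv₀ htop => ⟨?_, ?_⟩, ?_⟩
  · by_contra hre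
    exact hnot (unprojectedDense_fibreCurveSurface p (by omega) hre hirr h1)
  · -- the top-row point of maximal column dominates every column, else `topRight` applies
    set T := P.support.filter (fun v : Fin 2 →₀ ℕ => v 0 = v₀ 0) with hT
    obtain ⟨vR, hvRT, hmax⟩ := T.exists_max_image (fun v => v 1) ⟨v₀, Finset.mem_filter.2 ⟨hv₀, rfl⟩⟩
    obtain ⟨hvR, hvR0⟩ := Finset.mem_filter.1 hvRT
    refine ⟨vR, hvR, hvR0, fun u hu => ?_⟩
    by_contra hlt
    push Not at hlt
    refine hnot (unprojectedDense_fibreCurveSurface_of_topRight p hd hirr hvR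
      (fun v hv => hvR0 ▸ htop v hv) (fun v hv h => hmax v (Finset.mem_filter.2 ⟨hv, ?_⟩)) ⟨u, hu, hlt⟩)
    rw [h, hvR0]
  · set T := P.support.filter (fun v : Fin 2 →₀ ℕ => v 0 = v₀ 0) with hT
    obtain ⟨vL, hvLT, hmin⟩ := T.exists_min_image (fun v => v 1) ⟨v₀, Finset.mem_filter.2 ⟨hv₀, rfl⟩⟩
    obtain ⟨hvL, hvL0⟩ := Finset.mem_filter.1 hvLT
    refine ⟨vL, hvL, hvL0, fun u hu => ?_⟩
    by_contra hlt
    push Not at hlt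
    refine hnot (unprojectedDense_fibreCurveSurface_of_topLeft p hd hirr hvL
      (fun v hv => hvL0 ▸ htop v hv) (fun v hv h => hmin v (Finset.mem_filter.2 ⟨hv, ?_⟩)) ⟨u, hu, hlt⟩)
    rw [h, hvL0]
  · intro N₀ hN va hva vc hvc ha0 hc0 hne θ hθ0 hθ
    by_contra hgood
    exact hnot (unprojectedDense_fibreCurveSurface_of_topRow p hd hirr hN hva hvc ha0 hc0 hne hθ0 hθ
      hgood)

end Residual

/-! ## Part C. Examples with `Re(lc(p)·i^{deg p}) = 0` -/

section Examples

/-- The support of `y₀² - x₀` lies in `{y₀², x₀}`; `x₀` is its unique monomial of maximal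
`x₀`-degree. -/
theorem X1_sq_sub_X0_uniqueTop :
    ∀ v ∈ (X 1 ^ 2 - X 0 : MvPolynomial (Fin 2) ℂ).support,
      v ≠ Finsupp.single 0 1 → v 0 < (Finsupp.single (0 : Fin 2) 1 : Fin 2 →₀ ℕ) 0 := by
  classical
  intro v hv hne
  have hsub : (X 1 ^ 2 - X 0 : MvPolynomial (Fin 2) ℂ).support ⊆
      {Finsupp.single 1 2} ∪ {Finsupp.single 0 1} := by
    refine (MvPolynomial.support_sub (p := (X 1 ^ 2 : MvPolynomial (Fin 2) ℂ)) (q := X 0)).trans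
      (Finset.union_subset_union ?_ ?_)
    · rw [show (X 1 ^ 2 : MvPolynomial (Fin 2) ℂ) = monomial (Finsupp.single 1 2) 1 by
        rw [X_pow_eq_monomial]]
      exact support_monomial_subset
    · rw [show (X 0 : MvPolynomial (Fin 2) ℂ) = monomial (Finsupp.single 0 1) 1 by
        rw [X]]
      exact support_monomial_subset
  have hv' := hsub hv
  rw [Finset.mem_union, Finset.mem_singleton, Finset.mem_singleton] at hv'
  rcases hv' with h | h
  · rw [h]; simp
  · exact absurd h hne

/-- `x₀` is a monomial of `y₀² - x₀`. -/
theorem single_zero_mem_support_X1_sq_sub_X0 :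
    (Finsupp.single (0 : Fin 2) 1 : Fin 2 →₀ ℕ) ∈ (X 1 ^ 2 - X 0 : MvPolynomial (Fin 2) ℂ).support := by
  classical
  have hne : (Finsupp.single (1 : Fin 2) 2 : Fin 2 →₀ ℕ) ≠ Finsupp.single 0 1 := by
    intro h; have := DFunLike.congr_fun h 1; simp at this
  rw [MvPolynomial.mem_support_iff, MvPolynomial.coeff_sub, MvPolynomial.coeff_X_pow,
    MvPolynomial.coeff_X, if_neg hne, if_pos rfl]
  norm_num

/-- **Example `{x₁ = x₀³, y₀² = x₀}`** (`Re(1·i³) = 0`: not covered by gen 17's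
`unprojectedDense_fibreCurveSurface`): in Mantova–Masser's case, and the exponential points
`(z, z³, e^z, e^{z³})` with `e^{2z} = z` are Zariski dense. (new) -/
theorem unprojectedDensityQuestion_instance_cubic_y0sq_eq_x0 :
    MMCaseDimPiOneFree {w : Fin 2 ⊕ Fin 2 → ℂ |
        w (Sum.inl 1) = (Polynomial.X ^ 3 : Polynomial ℂ).eval (w (Sum.inl 0)) ∧
        MvPolynomial.eval ![w (Sum.inl 0), w (Sum.inr 0)]
          (X 1 ^ 2 - X 0 : MvPolynomial (Fin 2) ℂ) = 0} ∧
      UnprojectedDense {w : Fin 2 ⊕ Fin 2 → ℂ |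
        w (Sum.inl 1) = (Polynomial.X ^ 3 : Polynomial ℂ).eval (w (Sum.inl 0)) ∧
        MvPolynomial.eval ![w (Sum.inl 0), w (Sum.inr 0)]
          (X 1 ^ 2 - X 0 : MvPolynomial (Fin 2) ℂ) = 0} := by
  have hd : 2 ≤ (Polynomial.X ^ 3 : Polynomial ℂ).natDegree := by simp
  exact ⟨mmCase_fibreCurveSurface (Polynomial.X ^ 3) hd irreducible_X1_sq_sub_X0
      X1_sq_sub_X0_fibres_infinite,
    unprojectedDense_fibreCurveSurface_of_uniqueTop (Polynomial.X ^ 3) hd irreducible_X1_sq_sub_X0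
      X1_sq_sub_X0_support_pair single_zero_mem_support_X1_sq_sub_X0 X1_sq_sub_X0_uniqueTop⟩

/-- The same surface in plain coordinates: `{x₁ = x₀³, y₀² = x₀}` has Zariski-dense exponential
points. (new) -/
theorem unprojectedDense_cubic_y0sq_eq_x0 :
    UnprojectedDense {w : Fin 2 ⊕ Fin 2 → ℂ |
      w (Sum.inl 1) = w (Sum.inl 0) ^ 3 ∧ w (Sum.inr 0) ^ 2 = w (Sum.inl 0)} := by
  have h := unprojectedDensityQuestion_instance_cubic_y0sq_eq_x0.2
  have hset : {w : Fin 2 ⊕ Fin 2 → ℂ |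
        w (Sum.inl 1) = (Polynomial.X ^ 3 : Polynomial ℂ).eval (w (Sum.inl 0)) ∧
        MvPolynomial.eval ![w (Sum.inl 0), w (Sum.inr 0)]
          (X 1 ^ 2 - X 0 : MvPolynomial (Fin 2) ℂ) = 0} =
      {w : Fin 2 ⊕ Fin 2 → ℂ | w (Sum.inl 1) = w (Sum.inl 0) ^ 3 ∧
        w (Sum.inr 0) ^ 2 = w (Sum.inl 0)} := by
    ext w
    simp only [Set.mem_setOf_eq, Polynomial.eval_pow, Polynomial.eval_X, map_sub, map_pow,
      MvPolynomial.eval_X, Matrix.cons_val_zero, Matrix.cons_val_one, sub_eq_zero]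
  rw [← hset]
  exact h

/-- **Example `{x₁ = ix₀², y₀² = x₀}`** (`Re(i·i²) = 0`): in Mantova–Masser's case, and the
exponential points `(z, iz², e^z, e^{iz²})` with `e^{2z} = z` are Zariski dense. (new) -/
theorem unprojectedDensityQuestion_instance_iParabola_y0sq_eq_x0 :
    MMCaseDimPiOneFree {w : Fin 2 ⊕ Fin 2 → ℂ |
        w (Sum.inl 1) = (Polynomial.C I * Polynomial.X ^ 2 : Polynomial ℂ).eval (w (Sum.inl 0)) ∧
        MvPolynomial.eval ![w (Sum.inl 0), w (Sum.inr 0)]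
          (X 1 ^ 2 - X 0 : MvPolynomial (Fin 2) ℂ) = 0} ∧
      UnprojectedDense {w : Fin 2 ⊕ Fin 2 → ℂ |
        w (Sum.inl 1) = (Polynomial.C I * Polynomial.X ^ 2 : Polynomial ℂ).eval (w (Sum.inl 0)) ∧
        MvPolynomial.eval ![w (Sum.inl 0), w (Sum.inr 0)]
          (X 1 ^ 2 - X 0 : MvPolynomial (Fin 2) ℂ) = 0} := by
  have hd : 2 ≤ (Polynomial.C I * Polynomial.X ^ 2 : Polynomial ℂ).natDegree := by
    rw [Polynomial.natDegree_C_mul_X_pow 2 I Complex.I_ne_zero]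
  exact ⟨mmCase_fibreCurveSurface _ hd irreducible_X1_sq_sub_X0 X1_sq_sub_X0_fibres_infinite,
    unprojectedDense_fibreCurveSurface_of_uniqueTop _ hd irreducible_X1_sq_sub_X0
      X1_sq_sub_X0_support_pair single_zero_mem_support_X1_sq_sub_X0 X1_sq_sub_X0_uniqueTop⟩

/-- The same surface in plain coordinates: `{x₁ = ix₀², y₀² = x₀}` has Zariski-dense exponential
points. (new) -/
theorem unprojectedDense_iParabola_y0sq_eq_x0 :
    UnprojectedDense {w : Fin 2 ⊕ Fin 2 → ℂ |
      w (Sum.inl 1) = I * w (Sum.inl 0) ^ 2 ∧ w (Sum.inr 0) ^ 2 = w (Sum.inl 0)} := by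
  have h := unprojectedDensityQuestion_instance_iParabola_y0sq_eq_x0.2
  have hset : {w : Fin 2 ⊕ Fin 2 → ℂ |
        w (Sum.inl 1) = (Polynomial.C I * Polynomial.X ^ 2 : Polynomial ℂ).eval (w (Sum.inl 0)) ∧
        MvPolynomial.eval ![w (Sum.inl 0), w (Sum.inr 0)]
          (X 1 ^ 2 - X 0 : MvPolynomial (Fin 2) ℂ) = 0} =
      {w : Fin 2 ⊕ Fin 2 → ℂ | w (Sum.inl 1) = I * w (Sum.inl 0) ^ 2 ∧
        w (Sum.inr 0) ^ 2 = w (Sum.inl 0)} := by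
    ext w
    simp only [Set.mem_setOf_eq, Polynomial.eval_mul, Polynomial.eval_C, Polynomial.eval_pow,
      Polynomial.eval_X, map_sub, map_pow, MvPolynomial.eval_X, Matrix.cons_val_zero,
      Matrix.cons_val_one, sub_eq_zero]
  rw [← hset]
  exact h

end Examples

/-! ## Part D. The swapped rows `x₀ = p(x₁)` (fibre curve in the `(x₁, y₁)`-plane) -/

section Swap

variable (p : Polynomial ℂ) (P : MvPolynomial (Fin 2) ℂ)

/-- **Index swap for fibre curves.**  `{x₀ = p(x₁), P(x₁, y₁) = 0}` (with `y₀` free) is the index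
swap of `{x₁ = p(x₀), P(x₀, y₀) = 0}`; Zariski density of exponential points is invariant
(`unprojectedDense_indexSwapped_iff`, no hypotheses), so every fibre-curve theorem of gens 17–18
holds verbatim over `x₀ = p(x₁)`. [folklore] -/
theorem unprojectedDense_fibreCurveSurface_swap_iff :
    UnprojectedDense {w : Fin 2 ⊕ Fin 2 → ℂ | w (Sum.inl 0) = p.eval (w (Sum.inl 1)) ∧
        MvPolynomial.eval ![w (Sum.inl 1), w (Sum.inr 1)] P = 0} ↔
      UnprojectedDense {w : Fin 2 ⊕ Fin 2 → ℂ | w (Sum.inl 1) = p.eval (w (Sum.inl 0)) ∧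
        MvPolynomial.eval ![w (Sum.inl 0), w (Sum.inr 0)] P = 0} := by
  have hset : indexSwapped {w : Fin 2 ⊕ Fin 2 → ℂ | w (Sum.inl 1) = p.eval (w (Sum.inl 0)) ∧
      MvPolynomial.eval ![w (Sum.inl 0), w (Sum.inr 0)] P = 0} =
      {w : Fin 2 ⊕ Fin 2 → ℂ | w (Sum.inl 0) = p.eval (w (Sum.inl 1)) ∧
        MvPolynomial.eval ![w (Sum.inl 1), w (Sum.inr 1)] P = 0} := by
    ext w
    simp only [mem_indexSwapped_iff, Set.mem_setOf_eq, Function.comp_apply, idxSwap_inl_one,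
      idxSwap_inl_zero, idxSwap_inr_zero]
  rw [← hset, unprojectedDense_indexSwapped_iff]

variable {P}

/-- **Unique top monomial over `x₀ = p(x₁)`.**  `deg p ≥ 2`, `P` irreducible with two monomials of
different `y`-degree and a unique monomial of maximal `x`-degree ⟹ `{x₀ = p(x₁), P(x₁, y₁) = 0}` has
Zariski-dense exponential points. (new) -/
theorem unprojectedDense_fibreCurveSurface_of_uniqueTop_swap (hd : 2 ≤ p.natDegree)
    (hirr : Irreducible P) (h1 : ∃ v ∈ P.support, ∃ v' ∈ P.support, v 1 ≠ v' 1)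
    {v₀ : Fin 2 →₀ ℕ} (hv₀ : v₀ ∈ P.support) (huniq : ∀ v ∈ P.support, v ≠ v₀ → v 0 < v₀ 0) :
    UnprojectedDense {w : Fin 2 ⊕ Fin 2 → ℂ | w (Sum.inl 0) = p.eval (w (Sum.inl 1)) ∧
      MvPolynomial.eval ![w (Sum.inl 1), w (Sum.inr 1)] P = 0} :=
  (unprojectedDense_fibreCurveSurface_swap_iff p P).2
    (unprojectedDense_fibreCurveSurface_of_uniqueTop p hd hirr h1 hv₀ huniq)

end Swap

end Summit.Schanuel.Schanuel.Theorems
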